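import Summits.QuantumFields.YangMills.Theorems.UnitScaleTiltProp7PinnedRegaugeChartDiagonal
import Summits.QuantumFields.YangMills.Theorems.UnitScaleTiltProp7ExactCorrectorGaugeSockets
import Summits.QuantumFields.YangMills.Theorems.UnitScaleTiltProp7UntwistChartSplit
import Literature.MathematicalPhysics.QuantumFieldTheory.Balaban1983to89.B7Eq214FlatQprime
import HarnessLib

/-!
# Route `UnitScaleTilt`, crux K1 «MinimiserStabilityRegPr» (stmt-QuantumFields-19200), route-R E′ path (α′), (E1) «pinned slice theorem» — its STARTING POINT (row R2 ∕ (F1′)):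
# THE PURE-GAUGE PART OF `g := expHerm ∘ φ` RELATIVE TO `W` — `G_b := −i·log((W^g)_b·W_b⁻¹) = −D_Wφ(b) + O(‖φ‖·‖D_Wφ‖)` and its covariant DIVERGENCE
# `‖D*_W G + Δ_Wφ‖ ≤ 9d·(B₁² + 2B₀B₂)` from the three sup rows `B₀ ⊒ ‖φ‖`, `B₁ ⊒ ‖D_Wφ‖`, `B₂ ⊒ ‖D*_μD_μφ‖`

Cell `ym3-torus`, width seat `ym-ust-19200-w1` (gen 12); LOCATE `LOCATE-F1PRIME-SMOOTH-UNTWIST-w1g12.md` (19200 evidence n = 55), file (U2) of three.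
THEOREMS ONLY (0 `def`, 0 `sorry`); `--supports stmt-QuantumFields-19200`, count-neutral.  YM₃ on T³ is a ladder rung (R3), not the Clay problem; nothing here claims
a stub, the crux, d = 4 or the mass gap.

WHY.  (E1)'s contraction (✓ `Prop7ExactCorrectorContractionGauge`) needs a starting chart with `ℓ‖D‴‖_∞` AND `ℓ²‖divB 𝒰 D‴‖_∞` k-uniform.  With a σ-small twist
(print's (1.72)) the untwisting gauge is `g = expHerm ∘ φ` for a Hermitian-traceless site field `φ` that is C^{1,1} at scale `ℓ` (the framed corner blend, ✓
`Prop7CornerBlendSupRows`).  THIS FILE turns the three sup rows of `φ` into the two rows of the PURE-GAUGE PART `G` of `g` relative to `W`, entirely through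
ym3-torus-px15's landed BCH letters: the zeroth order is ✓ `Prop7PinnedRegaugeChartBCH.norm_mlog_mul_exp_neg_mlog_add_sub_le` ((31) refined, bilinear in
`‖log u‖·‖δ‖`) read through ✓ `Prop7PinnedRegaugeChartDiagonal.regauge_eq_mul_mul_exp` at `E := 1`; the divergence is the DIAGONAL Lipschitz letter ★★ ✓
`norm_diagBCH_sub_diagBCH_le` applied to the pair (transported `(g(x−e_μ), δ(x−e_μ))`, `(g(x), δ(x))`): its partners are exactly `‖D_Wφ(x−e_μ)‖` (with weight
`9B₁`) and `‖D*_μD_μφ(x)‖` (with weight `9σ_u`, `σ_u = 2B₀`) — which is why ✓ `Prop7CornerBlendSupRows` books the second-order row PER DIRECTION.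

WHAT IS PROVED (ns `…Theorems.Prop7PureGaugeOfExpRows`; any `Params`, level `j`, `W : GaugeField P j SU(2)`, `𝒰 := fun κ z => unitsField (toUField W) ⟨z, κ⟩`,
`T := torusT P j`; `φ : Site P j → M₂(ℂ)` Hermitian-traceless; `g := fun x => expHerm (φ x)`).
* §1 letters: `R_unitsField_eq` (`R(𝒰_b)X = W_b·X·W_b*`), `coe_ratio_eq` (`↑((W^g)_b·W_b⁻¹) = g₋·W_b·g₊*·W_b*`), `mlog_coe_expHerm` (`log ↑(g x) = i·φ x`),
  `norm_coe_expHerm_sub_one_le` (`≤ 2B₀`), ★ `mlog_sub_conj_mlog_eq` (`log g₋ − W_b·log g₊·W_b* = −i·D_Wφ(b)`), `norm_ratio_sub_one_le` (`‖↑((W^g)_bW_b⁻¹) − 1‖ ≤ B₁·e^{B₀}`).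
* §2 ★★ `pureGauge_add_covD_eq` (`G_b + D_Wφ(b) = −i·Ψ(g₋, δ_b)` with px15's `Ψ(u,δ) = log(u·e^{−log u + δ}) − δ`), ★★ `norm_pureGauge_add_covD_le` (`≤ 3‖φ(b₋)‖·‖D_Wφ(b)‖`),
  `norm_pureGauge_le` (`‖G_b‖ ≤ (1 + 3B₀)·B₁`), `pureGauge_isHermitian_trace` (`G_b` Hermitian, traceless).
* §3 ★★★ `norm_transport_rho_sub_rho_le` — `‖R(𝒰(x−e_μ)⁻¹)ρ(x−e_μ, μ) − ρ(x, μ)‖ ≤ 9B₁·‖D_Wφ(x−e_μ, μ)‖ + 18B₀·‖D*_μD_μφ(x)‖` for `ρ := G + D_Wφ`.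
* §4 ★★★ `norm_divB_pureGauge_add_lap_le` (`‖divB 𝒰 G x + Δ_𝒰φ x‖ ≤ Σ_μ (9B₁‖D_Wφ(x−e_μ,μ)‖ + 18B₀‖D*_μD_μφ x‖)`), ★★★ `norm_divB_pureGauge_le`
  (`‖divB 𝒰 G x‖ ≤ d·B₂ + d·(9B₁² + 18B₀B₂)`).
HONEST SCOPE.  Pointwise matrix bookkeeping over landed letters; windows `B₀ ≤ 1∕512`, `B₁ ≤ 1∕256`; the chart of `X^g` for a competitor `X = e^{iA₀}W` (split ✓
`Prop7UntwistChartSplit` + the divergence transfer of `Ad_{g₋}A₀`) is file (U3); nothing of Bałaban's beyond (31) is asserted.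

References: T. Bałaban, CMP 98 (1985) 17–51 [Balaban1985Averaging] ((31) p.22, (8) p.19, (21) p.21); CMP 99 (1985) 389–434 [Balaban1985BackgroundPropagators]
((3.3) p.390, (3.8) p.392); CMP 99 (1985) 75–102 [Balaban1985RegularSpaces] ((1.72) p.88, Thm 2 p.83); CMP 102 (1985) 277–309 [Balaban1985Variational] ((15) p.280).
-/

set_option autoImplicit false

noncomputable section

open scoped BigOperators Matrix.Norms.L2Operator
open NormedSpace

namespace Summit.QuantumFields.YangMills.Theorems.Prop7PureGaugeOfExpRows

open Literature.MathematicalPhysics.QuantumFieldTheory.Balaban1983to89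
open B9Eq39Adjoint (R R_def R_add R_sub R_smul R_neg covD covDstar divB)
open B9Eq310Hermitian (norm_R_le)
open B9TorusCalculus (torusT torusT_apply torusT_symm_apply)
open B10Eq27TorusAxialLog (unitsField toUField)
open MatrixLog (mlog exp_mlog)
open B7BlockAvgLog (mlog_exp)
open Summit.QuantumFields.YangMills.Theorems.Prop7TPrint (expHerm coe_expHerm)
open Summit.QuantumFields.YangMills.Theorems.Prop7BlendSite (coe_inv_SU)
open Summit.QuantumFields.YangMills.Theorems.Prop7HolRatioPerStep (coe_star_mul_self coe_mul_star_self norm_coe_eq_one)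
open Summit.QuantumFields.YangMills.Theorems.Prop7CovIterLambdaBound (norm_conj_su_le)
open Summit.QuantumFields.YangMills.Theorems.Prop7PinnedRegaugeChartBCH (norm_mlog_mul_exp_neg_mlog_add_sub_le norm_twist_sub_one_le)
open Summit.QuantumFields.YangMills.Theorems.Prop7PinnedRegaugeChartDiagonal (norm_diagBCH_sub_diagBCH_le regauge_eq_mul_mul_exp)
open Summit.QuantumFields.YangMills.Theorems.Prop7ExactCorrectorGaugeSockets (unitsField_toUField_norm_le_one)
open Summit.QuantumFields.YangMills.Theorems.Prop7UntwistedChartOfBlend (hermLog_isHermitian hermLog_trace)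

variable {P : Params} {j : ℕ}

/-! ## §1 Letters: the background conjugation, the pure-gauge ratio, the exponential gauge -/

section Letters

/-- The units of the background invert to the adjoints: `↑(𝒰_b⁻¹) = W_b*`. [cite: Balaban1985Averaging, (19) p.21] -/
theorem val_inv_unitsField (W : GaugeField P j (Matrix.specialUnitaryGroup (Fin 2) ℂ)) (b : PBond P j) :
    (((unitsField (toUField W) b)⁻¹ : (Matrix (Fin 2) (Fin 2) ℂ)ˣ) : Matrix (Fin 2) (Fin 2) ℂ) = star ((W b : Matrix.specialUnitaryGroup (Fin 2) ℂ) : Matrix (Fin 2) (Fin 2) ℂ) := by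
  show (((Unitary.toUnits (B10Eq27TorusAxialLog.suIncl (W b)))⁻¹ : (Matrix (Fin 2) (Fin 2) ℂ)ˣ) : Matrix (Fin 2) (Fin 2) ℂ) = _
  rw [← map_inv]
  rfl

/-- `R(𝒰_b)X = W_b·X·W_b*` — the background conjugation of the (E1) letters, written out. [cite: Balaban1985BackgroundPropagators, (3.3) p.390] -/
theorem R_unitsField_eq (W : GaugeField P j (Matrix.specialUnitaryGroup (Fin 2) ℂ)) (b : PBond P j) (X : Matrix (Fin 2) (Fin 2) ℂ) :
    R (unitsField (toUField W) b) X = ((W b : Matrix.specialUnitaryGroup (Fin 2) ℂ) : Matrix (Fin 2) (Fin 2) ℂ) * X * star ((W b : Matrix.specialUnitaryGroup (Fin 2) ℂ) : Matrix (Fin 2) (Fin 2) ℂ) := by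
  rw [R_def, val_inv_unitsField]; rfl

/-- `R(𝒰_b⁻¹)X = W_b*·X·W_b`. [cite: Balaban1985BackgroundPropagators, (3.8) p.392] -/
theorem R_inv_unitsField_eq (W : GaugeField P j (Matrix.specialUnitaryGroup (Fin 2) ℂ)) (b : PBond P j) (X : Matrix (Fin 2) (Fin 2) ℂ) :
    R ((unitsField (toUField W) b)⁻¹) X = star ((W b : Matrix.specialUnitaryGroup (Fin 2) ℂ) : Matrix (Fin 2) (Fin 2) ℂ) * X * ((W b : Matrix.specialUnitaryGroup (Fin 2) ℂ) : Matrix (Fin 2) (Fin 2) ℂ) := by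
  rw [R_def, inv_inv, val_inv_unitsField]; rfl

/-- **THE PURE-GAUGE RATIO IN MATRICES**: `↑((W^g)_b·W_b⁻¹) = g(b₋)·W_b·g(b₊)*·W_b*`. [cite: Balaban1985Averaging, (8) p.19] -/
theorem coe_ratio_eq (W : GaugeField P j (Matrix.specialUnitaryGroup (Fin 2) ℂ)) (g : GaugeTransf P j (Matrix.specialUnitaryGroup (Fin 2) ℂ)) (b : PBond P j) :
    ((GaugeField.gaugeAct g W b * (W b)⁻¹ : Matrix.specialUnitaryGroup (Fin 2) ℂ) : Matrix (Fin 2) (Fin 2) ℂ)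
      = ((g b.src : Matrix.specialUnitaryGroup (Fin 2) ℂ) : Matrix (Fin 2) (Fin 2) ℂ) * ((W b : Matrix.specialUnitaryGroup (Fin 2) ℂ) : Matrix (Fin 2) (Fin 2) ℂ)
          * star ((g b.tgt : Matrix.specialUnitaryGroup (Fin 2) ℂ) : Matrix (Fin 2) (Fin 2) ℂ) * star ((W b : Matrix.specialUnitaryGroup (Fin 2) ℂ) : Matrix (Fin 2) (Fin 2) ℂ) := by
  show (((g b.src * W b * (g b.tgt)⁻¹) * (W b)⁻¹ : Matrix.specialUnitaryGroup (Fin 2) ℂ) : Matrix (Fin 2) (Fin 2) ℂ) = _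
  rw [Submonoid.coe_mul, Submonoid.coe_mul, Submonoid.coe_mul, coe_inv_SU, coe_inv_SU]

/-- `R(V)` of the diagonal BCH remainder is the remainder of the conjugated data: `R(V)(log(u·e^{−log u + δ}) − δ) = log(ũ·e^{−log ũ + R(V)δ}) − R(V)δ` with
`↑ũ = R(V)↑u` (equivariance of `log`∕`exp` under unit conjugation). [cite: Balaban1985Averaging, (21) p.21, Sect. B p.24] -/
theorem R_diagBCH_eq (V : (Matrix (Fin 2) (Fin 2) ℂ)ˣ) (u ũ : Matrix.specialUnitaryGroup (Fin 2) ℂ) (hũ : (ũ : Matrix (Fin 2) (Fin 2) ℂ) = R V (u : Matrix (Fin 2) (Fin 2) ℂ)) (δ : Matrix (Fin 2) (Fin 2) ℂ) :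
    R V (mlog ((u : Matrix (Fin 2) (Fin 2) ℂ) * exp (-mlog (u : Matrix (Fin 2) (Fin 2) ℂ) + δ)) - δ)
      = mlog ((ũ : Matrix (Fin 2) (Fin 2) ℂ) * exp (-mlog (ũ : Matrix (Fin 2) (Fin 2) ℂ) + R V δ)) - R V δ := by
  have hlog : ∀ X : Matrix (Fin 2) (Fin 2) ℂ, R V (mlog X) = mlog (R V X) := fun X => by
    rw [R_def, R_def, B7Prop6Flat.mlog_conj]
  have hexp : ∀ X : Matrix (Fin 2) (Fin 2) ℂ, R V (exp X) = exp (R V X) := fun X => by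
    rw [R_def, R_def, Matrix.exp_units_conj]
  rw [R_sub, hlog, ← B9Eq39Adjoint.R_mul_R, hexp, R_add, R_neg, hlog, hũ]

variable (φ : Site P j → Matrix (Fin 2) (Fin 2) ℂ) (hφ : ∀ x, (φ x).IsHermitian ∧ Matrix.trace (φ x) = 0)
include hφ

/-- `↑(expHerm (φ x)) = e^{iφ(x)}`. [cite: Balaban1985Variational, (112) p.294] -/
theorem coe_gauge_eq (x : Site P j) : ((expHerm (φ x) : Matrix.specialUnitaryGroup (Fin 2) ℂ) : Matrix (Fin 2) (Fin 2) ℂ) = exp (Complex.I • φ x) :=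
  coe_expHerm (hφ x)

/-- `log ↑(expHerm (φ x)) = i·φ x` for `‖φ x‖ ≤ B₀ ≤ 1∕2` (`log 2 > 1∕2`). [cite: Balaban1985Averaging, (21) p.21] -/
theorem mlog_coe_gauge_eq {B₀ : ℝ} (hB₀ : ∀ x, ‖φ x‖ ≤ B₀) (hB : B₀ ≤ 1 / 2) (x : Site P j) :
    mlog ((expHerm (φ x) : Matrix.specialUnitaryGroup (Fin 2) ℂ) : Matrix (Fin 2) (Fin 2) ℂ) = Complex.I • φ x := by
  rw [coe_gauge_eq φ hφ]
  refine mlog_exp ?_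
  rw [norm_smul, Complex.norm_I, one_mul]
  have h2 : (1 : ℝ) / 2 < Real.log 2 := by
    have := Real.log_two_gt_d9; linarith
  exact lt_of_le_of_lt ((hB₀ x).trans hB) h2

/-- `‖↑(expHerm (φ x)) − 1‖ ≤ 2B₀` for `‖φ x‖ ≤ B₀ ≤ 1`. [cite: Balaban1985Averaging, (24) p.21] -/
theorem norm_coe_gauge_sub_one_le {B₀ : ℝ} (hB₀ : ∀ x, ‖φ x‖ ≤ B₀) (hB : B₀ ≤ 1) (x : Site P j) :
    ‖((expHerm (φ x) : Matrix.specialUnitaryGroup (Fin 2) ℂ) : Matrix (Fin 2) (Fin 2) ℂ) - 1‖ ≤ 2 * B₀ := by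
  rw [coe_gauge_eq φ hφ]
  refine B7Eq214FlatQprime.norm_exp_sub_one_le_two_mul ?_ hB
  rw [norm_smul, Complex.norm_I, one_mul]; exact hB₀ x

/-- ★ **THE CORRECTOR'S VARIABLE IS THE COVARIANT DIFFERENCE**: `log ↑(g x) − W_b·log ↑(g(x+e_μ))·W_b* = −i·(D_𝒰φ)(x, μ)`, `b = (x, μ)`.
[cite: Balaban1985BackgroundPropagators, (3.3) p.390; Balaban1985Averaging, (21) p.21] -/
theorem mlog_sub_conj_mlog_eq (W : GaugeField P j (Matrix.specialUnitaryGroup (Fin 2) ℂ)) {B₀ : ℝ} (hB₀ : ∀ x, ‖φ x‖ ≤ B₀) (hB : B₀ ≤ 1 / 2)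
    (μ : Fin P.d) (x : Site P j) :
    mlog ((expHerm (φ x) : Matrix.specialUnitaryGroup (Fin 2) ℂ) : Matrix (Fin 2) (Fin 2) ℂ)
        - ((W ⟨x, μ⟩ : Matrix.specialUnitaryGroup (Fin 2) ℂ) : Matrix (Fin 2) (Fin 2) ℂ) * mlog ((expHerm (φ (torusT P j μ x)) : Matrix.specialUnitaryGroup (Fin 2) ℂ) : Matrix (Fin 2) (Fin 2) ℂ)
            * star ((W ⟨x, μ⟩ : Matrix.specialUnitaryGroup (Fin 2) ℂ) : Matrix (Fin 2) (Fin 2) ℂ)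
      = -(Complex.I • covD (torusT P j) (fun κ z => unitsField (toUField W) ⟨z, κ⟩) μ φ x) := by
  rw [mlog_coe_gauge_eq φ hφ hB₀ hB, mlog_coe_gauge_eq φ hφ hB₀ hB]
  show _ = -(Complex.I • (R (unitsField (toUField W) ⟨x, μ⟩) (φ (torusT P j μ x)) - φ x))
  rw [R_unitsField_eq, Matrix.mul_smul, Matrix.smul_mul, smul_sub]
  abel

/-- **THE RATIO IS NEAR `1`**: `‖↑((W^g)_b·W_b⁻¹) − 1‖ ≤ ‖D_𝒰φ(b)‖·e^{B₀}` (so `≤ B₁e^{B₀}`). [cite: Balaban1985Averaging, (24) p.21; Balaban1985BackgroundPropagators, (3.3) p.390] -/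
theorem norm_ratio_sub_one_le (W : GaugeField P j (Matrix.specialUnitaryGroup (Fin 2) ℂ)) {B₀ : ℝ} (hB₀ : ∀ x, ‖φ x‖ ≤ B₀) (μ : Fin P.d) (x : Site P j) :
    ‖((GaugeField.gaugeAct (fun z => expHerm (φ z)) W ⟨x, μ⟩ * (W ⟨x, μ⟩)⁻¹ : Matrix.specialUnitaryGroup (Fin 2) ℂ) : Matrix (Fin 2) (Fin 2) ℂ) - 1‖
      ≤ ‖covD (torusT P j) (fun κ z => unitsField (toUField W) ⟨z, κ⟩) μ φ x‖ * Real.exp B₀ := by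
  rw [coe_ratio_eq]
  refine (norm_twist_sub_one_le _ _ _).trans ?_
  have htgt : (⟨x, μ⟩ : PBond P j).tgt = torusT P j μ x := rfl
  rw [htgt]
  show ‖((expHerm (φ x) : Matrix.specialUnitaryGroup (Fin 2) ℂ) : Matrix (Fin 2) (Fin 2) ℂ)
      - ((W ⟨x, μ⟩ : Matrix.specialUnitaryGroup (Fin 2) ℂ) : Matrix (Fin 2) (Fin 2) ℂ) * ((expHerm (φ (torusT P j μ x)) : Matrix.specialUnitaryGroup (Fin 2) ℂ) : Matrix (Fin 2) (Fin 2) ℂ)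
          * star ((W ⟨x, μ⟩ : Matrix.specialUnitaryGroup (Fin 2) ℂ) : Matrix (Fin 2) (Fin 2) ℂ)‖ ≤ _
  rw [coe_gauge_eq φ hφ, coe_gauge_eq φ hφ]
  have hconj : ((W ⟨x, μ⟩ : Matrix.specialUnitaryGroup (Fin 2) ℂ) : Matrix (Fin 2) (Fin 2) ℂ) * exp (Complex.I • φ (torusT P j μ x))
        * star ((W ⟨x, μ⟩ : Matrix.specialUnitaryGroup (Fin 2) ℂ) : Matrix (Fin 2) (Fin 2) ℂ)
      = exp (Complex.I • R (unitsField (toUField W) ⟨x, μ⟩) (φ (torusT P j μ x))) := by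
    rw [R_unitsField_eq, ← Matrix.smul_mul, ← Matrix.mul_smul, Prop7GaugeTwistLogRatio.exp_conj_coe]
  rw [hconj]
  have h1 : ‖Complex.I • φ x‖ ≤ B₀ := by rw [norm_smul, Complex.norm_I, one_mul]; exact hB₀ x
  have h2 : ‖Complex.I • R (unitsField (toUField W) ⟨x, μ⟩) (φ (torusT P j μ x))‖ ≤ B₀ := by
    rw [norm_smul, Complex.norm_I, one_mul]
    exact (norm_R_le (unitsField_toUField_norm_le_one W _).1 (unitsField_toUField_norm_le_one W _).2 _).trans (hB₀ _)
  refine (Literature.Analysis.Complex.norm_exp_sub_exp_le _ _).trans ?_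
  have hmax : Real.exp (max ‖Complex.I • φ x‖ ‖Complex.I • R (unitsField (toUField W) ⟨x, μ⟩) (φ (torusT P j μ x))‖) ≤ Real.exp B₀ :=
    Real.exp_le_exp.2 (max_le h1 h2)
  have hdiff : ‖Complex.I • φ x - Complex.I • R (unitsField (toUField W) ⟨x, μ⟩) (φ (torusT P j μ x))‖
      = ‖covD (torusT P j) (fun κ z => unitsField (toUField W) ⟨z, κ⟩) μ φ x‖ := by
    rw [← smul_sub, norm_smul, Complex.norm_I, one_mul, ← norm_neg, neg_sub]
    rfl
  rw [hdiff]
  exact mul_le_mul_of_nonneg_left hmax (norm_nonneg _)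

end Letters

/-! ## §2 The pure-gauge part to zeroth order -/

section Zeroth

variable (W : GaugeField P j (Matrix.specialUnitaryGroup (Fin 2) ℂ)) (φ : Site P j → Matrix (Fin 2) (Fin 2) ℂ)
  (hφ : ∀ x, (φ x).IsHermitian ∧ Matrix.trace (φ x) = 0)
include hφ

/-- ★★ **`G_b + D_𝒰φ(b) = −i·Ψ(g(b₋), δ_b)`** with px15's diagonal BCH remainder `Ψ(u, δ) = log(u·e^{−log u + δ}) − δ` and `δ_b = −i·D_𝒰φ(b)` — exact.
[cite: Balaban1985Averaging, (31) p.22, (8) p.19] -/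
theorem pureGauge_add_covD_eq {B₀ : ℝ} (hB₀ : ∀ x, ‖φ x‖ ≤ B₀) (hB : B₀ ≤ 1 / 4) (μ : Fin P.d) (x : Site P j) :
    (-Complex.I) • mlog ((GaugeField.gaugeAct (fun z => expHerm (φ z)) W ⟨x, μ⟩ * (W ⟨x, μ⟩)⁻¹ : Matrix.specialUnitaryGroup (Fin 2) ℂ) : Matrix (Fin 2) (Fin 2) ℂ)
        + covD (torusT P j) (fun κ z => unitsField (toUField W) ⟨z, κ⟩) μ φ x
      = (-Complex.I) • (mlog (((expHerm (φ x) : Matrix.specialUnitaryGroup (Fin 2) ℂ) : Matrix (Fin 2) (Fin 2) ℂ)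
            * exp (-mlog ((expHerm (φ x) : Matrix.specialUnitaryGroup (Fin 2) ℂ) : Matrix (Fin 2) (Fin 2) ℂ)
              + -(Complex.I • covD (torusT P j) (fun κ z => unitsField (toUField W) ⟨z, κ⟩) μ φ x)))
          - -(Complex.I • covD (torusT P j) (fun κ z => unitsField (toUField W) ⟨z, κ⟩) μ φ x)) := by
  have hB1 : B₀ ≤ 1 := hB.trans (by norm_num)
  have hB2 : B₀ ≤ 1 / 2 := hB.trans (by norm_num)
  have hup : ‖((expHerm (φ (torusT P j μ x)) : Matrix.specialUnitaryGroup (Fin 2) ℂ) : Matrix (Fin 2) (Fin 2) ℂ) - 1‖ < 1 := by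
    have := norm_coe_gauge_sub_one_le φ hφ hB₀ hB1 (torusT P j μ x); linarith
  have hratio := regauge_eq_mul_mul_exp (expHerm (φ x)) (expHerm (φ (torusT P j μ x))) (W ⟨x, μ⟩) 1 hup
  rw [mul_one, mlog_sub_conj_mlog_eq φ hφ W hB₀ hB2 μ x] at hratio
  have htgt : (⟨x, μ⟩ : PBond P j).tgt = torusT P j μ x := rfl
  rw [coe_ratio_eq, htgt]
  show (-Complex.I) • mlog (((expHerm (φ x) : Matrix.specialUnitaryGroup (Fin 2) ℂ) : Matrix (Fin 2) (Fin 2) ℂ)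
        * ((W ⟨x, μ⟩ : Matrix.specialUnitaryGroup (Fin 2) ℂ) : Matrix (Fin 2) (Fin 2) ℂ)
        * star ((expHerm (φ (torusT P j μ x)) : Matrix.specialUnitaryGroup (Fin 2) ℂ) : Matrix (Fin 2) (Fin 2) ℂ)
        * star ((W ⟨x, μ⟩ : Matrix.specialUnitaryGroup (Fin 2) ℂ) : Matrix (Fin 2) (Fin 2) ℂ)) + _ = _
  rw [hratio, smul_sub, smul_neg, smul_smul, show (-Complex.I) * Complex.I = 1 by rw [neg_mul, Complex.I_mul_I, neg_neg], one_smul]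
  abel

/-- ★★ **THE PURE-GAUGE PART IS `−D_𝒰φ` TO ZEROTH ORDER**: `‖G_b + D_𝒰φ(b)‖ ≤ 3‖φ(b₋)‖·‖D_𝒰φ(b)‖` for `‖φ‖ ≤ B₀ ≤ 1∕128` and `‖D_𝒰φ(b)‖ ≤ 1∕16`.
[cite: Balaban1985Averaging, (31) p.22, (8) p.19; Balaban1985BackgroundPropagators, (3.3) p.390] -/
theorem norm_pureGauge_add_covD_le {B₀ : ℝ} (hB₀ : ∀ x, ‖φ x‖ ≤ B₀) (hB : B₀ ≤ 1 / 128) (μ : Fin P.d) (x : Site P j)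
    (hδ : ‖covD (torusT P j) (fun κ z => unitsField (toUField W) ⟨z, κ⟩) μ φ x‖ ≤ 1 / 16) :
    ‖(-Complex.I) • mlog ((GaugeField.gaugeAct (fun z => expHerm (φ z)) W ⟨x, μ⟩ * (W ⟨x, μ⟩)⁻¹ : Matrix.specialUnitaryGroup (Fin 2) ℂ) : Matrix (Fin 2) (Fin 2) ℂ)
        + covD (torusT P j) (fun κ z => unitsField (toUField W) ⟨z, κ⟩) μ φ x‖
      ≤ 3 * ‖φ x‖ * ‖covD (torusT P j) (fun κ z => unitsField (toUField W) ⟨z, κ⟩) μ φ x‖ := by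
  have hB4 : B₀ ≤ 1 / 4 := hB.trans (by norm_num)
  have hB2 : B₀ ≤ 1 / 2 := hB.trans (by norm_num)
  have hB1 : B₀ ≤ 1 := hB.trans (by norm_num)
  have heq := pureGauge_add_covD_eq W φ hφ hB₀ hB4 μ x
  rw [heq, norm_smul, norm_neg, Complex.norm_I, one_mul]
  have hu : ‖((expHerm (φ x) : Matrix.specialUnitaryGroup (Fin 2) ℂ) : Matrix (Fin 2) (Fin 2) ℂ) - 1‖ ≤ 1 / 64 := by
    have := norm_coe_gauge_sub_one_le φ hφ hB₀ hB1 x; linarith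
  have hδ' : ‖-(Complex.I • covD (torusT P j) (fun κ z => unitsField (toUField W) ⟨z, κ⟩) μ φ x)‖ ≤ 1 / 16 := by
    rw [norm_neg, norm_smul, Complex.norm_I, one_mul]; exact hδ
  have h31 := norm_mlog_mul_exp_neg_mlog_add_sub_le (expHerm (φ x)) (-(Complex.I • covD (torusT P j) (fun κ z => unitsField (toUField W) ⟨z, κ⟩) μ φ x)) hu hδ'
  have hlog : ‖mlog ((expHerm (φ x) : Matrix.specialUnitaryGroup (Fin 2) ℂ) : Matrix (Fin 2) (Fin 2) ℂ)‖ = ‖φ x‖ := by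
    rw [mlog_coe_gauge_eq φ hφ hB₀ hB2 x, norm_smul, Complex.norm_I, one_mul]
  have hnδ : ‖-(Complex.I • covD (torusT P j) (fun κ z => unitsField (toUField W) ⟨z, κ⟩) μ φ x)‖
      = ‖covD (torusT P j) (fun κ z => unitsField (toUField W) ⟨z, κ⟩) μ φ x‖ := by
    rw [norm_neg, norm_smul, Complex.norm_I, one_mul]
  rw [hlog, hnδ] at h31
  exact h31

/-- ★ **SUP ROW OF THE PURE-GAUGE PART**: `‖G_b‖ ≤ (1 + 3B₀)·B₁` under the sup rows `‖φ‖ ≤ B₀ ≤ 1∕128`, `‖D_𝒰φ‖ ≤ B₁ ≤ 1∕16`.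
[cite: Balaban1985Averaging, (31) p.22; Balaban1985RegularSpaces, (1.36) p.82] -/
theorem norm_pureGauge_le {B₀ B₁ : ℝ} (hB₀ : ∀ x, ‖φ x‖ ≤ B₀) (hB : B₀ ≤ 1 / 128)
    (hB₁ : ∀ μ x, ‖covD (torusT P j) (fun κ z => unitsField (toUField W) ⟨z, κ⟩) μ φ x‖ ≤ B₁) (hB₁' : B₁ ≤ 1 / 16) (μ : Fin P.d) (x : Site P j) :
    ‖(-Complex.I) • mlog ((GaugeField.gaugeAct (fun z => expHerm (φ z)) W ⟨x, μ⟩ * (W ⟨x, μ⟩)⁻¹ : Matrix.specialUnitaryGroup (Fin 2) ℂ) : Matrix (Fin 2) (Fin 2) ℂ)‖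
      ≤ (1 + 3 * B₀) * B₁ := by
  have h := norm_pureGauge_add_covD_le W φ hφ hB₀ hB μ x ((hB₁ μ x).trans hB₁')
  have hB0 : 0 ≤ B₀ := (norm_nonneg _).trans (hB₀ x)
  have hc := hB₁ μ x
  have hc0 := norm_nonneg (covD (torusT P j) (fun κ z => unitsField (toUField W) ⟨z, κ⟩) μ φ x)
  have hφx := hB₀ x
  have hφ0 := norm_nonneg (φ x)
  have htri : ‖((-Complex.I) • mlog ((GaugeField.gaugeAct (fun z => expHerm (φ z)) W ⟨x, μ⟩ * (W ⟨x, μ⟩)⁻¹ : Matrix.specialUnitaryGroup (Fin 2) ℂ) : Matrix (Fin 2) (Fin 2) ℂ))‖ ≤ ‖((-Complex.I) • mlog ((GaugeField.gaugeAct (fun z => expHerm (φ z)) W ⟨x, μ⟩ * (W ⟨x, μ⟩)⁻¹ : Matrix.specialUnitaryGroup (Fin 2) ℂ) : Matrix (Fin 2) (Fin 2) ℂ)) + (covD (torusT P j) (fun κ z => unitsField (toUField W) ⟨z, κ⟩) μ φ x)‖ + ‖(covD (torusT P j) (fun κ z => unitsField (toUField W) ⟨z, κ⟩) μ φ x)‖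 := by
    have := norm_sub_le (((-Complex.I) • mlog ((GaugeField.gaugeAct (fun z => expHerm (φ z)) W ⟨x, μ⟩ * (W ⟨x, μ⟩)⁻¹ : Matrix.specialUnitaryGroup (Fin 2) ℂ) : Matrix (Fin 2) (Fin 2) ℂ)) + (covD (torusT P j) (fun κ z => unitsField (toUField W) ⟨z, κ⟩) μ φ x)) (covD (torusT P j) (fun κ z => unitsField (toUField W) ⟨z, κ⟩) μ φ x)
    rwa [add_sub_cancel_right] at this
  have hprod : 3 * ‖φ x‖ * ‖(covD (torusT P j) (fun κ z => unitsField (toUField W) ⟨z, κ⟩) μ φ x)‖ ≤ 3 * B₀ * B₁ :=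
    mul_le_mul (mul_le_mul_of_nonneg_left hφx (by norm_num)) hc hc0 (by positivity)
  linarith [htri, hprod, h, hc]

/-- `G_b` is Hermitian and traceless (the ratio is special unitary within `1∕3` of `1` once `B₁e^{B₀} ≤ 1∕3`). [cite: Balaban1985Averaging, (19)-(21) p.21] -/
theorem pureGauge_isHermitian_trace {B₀ B₁ : ℝ} (hB₀ : ∀ x, ‖φ x‖ ≤ B₀)
    (hB₁ : ∀ μ x, ‖covD (torusT P j) (fun κ z => unitsField (toUField W) ⟨z, κ⟩) μ φ x‖ ≤ B₁) (hw : B₁ * Real.exp B₀ ≤ 1 / 3) (μ : Fin P.d) (x : Site P j) :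
    ((-Complex.I) • mlog ((GaugeField.gaugeAct (fun z => expHerm (φ z)) W ⟨x, μ⟩ * (W ⟨x, μ⟩)⁻¹ : Matrix.specialUnitaryGroup (Fin 2) ℂ) : Matrix (Fin 2) (Fin 2) ℂ)).IsHermitian
    ∧ Matrix.trace ((-Complex.I) • mlog ((GaugeField.gaugeAct (fun z => expHerm (φ z)) W ⟨x, μ⟩ * (W ⟨x, μ⟩)⁻¹ : Matrix.specialUnitaryGroup (Fin 2) ℂ) : Matrix (Fin 2) (Fin 2) ℂ)) = 0 := by
  set Q : Matrix.specialUnitaryGroup (Fin 2) ℂ := GaugeField.gaugeAct (fun z => expHerm (φ z)) W ⟨x, μ⟩ * (W ⟨x, μ⟩)⁻¹ with hQ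
  have hQ3 : ‖(Q : Matrix (Fin 2) (Fin 2) ℂ) - 1‖ ≤ 1 / 3 := by
    refine (norm_ratio_sub_one_le φ hφ W hB₀ μ x).trans ?_
    exact (mul_le_mul_of_nonneg_right (hB₁ μ x) (Real.exp_pos _).le).trans hw
  have hQm := Matrix.mem_specialUnitaryGroup_iff.1 Q.2
  exact ⟨hermLog_isHermitian hQm.1 hQ3, hermLog_trace hQm.2 hQ3⟩

end Zeroth

/-! ## §3 The transported difference of the remainder `ρ = G + D_𝒰φ` along one direction -/

section Transport

variable (W : GaugeField P j (Matrix.specialUnitaryGroup (Fin 2) ℂ)) (φ : Site P j → Matrix (Fin 2) (Fin 2) ℂ)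
  (hφ : ∀ x, (φ x).IsHermitian ∧ Matrix.trace (φ x) = 0)
include hφ

/-- ★★★ **THE TRANSPORTED DIFFERENCE OF `ρ := G + D_𝒰φ` ALONG `μ`** (`x′ = x − e_μ`, `V = 𝒰(x′, μ)⁻¹`): under the sup rows `‖φ‖ ≤ B₀ ≤ 1∕512`, `‖D_𝒰φ‖ ≤ B₁ ≤ 1∕256`,
`‖R(V)ρ(x′, μ) − ρ(x, μ)‖ ≤ 9B₁·‖D_𝒰φ(x′, μ)‖ + 18B₀·‖D*_μD_μφ(x)‖` — ym3-torus-px15's diagonal Lipschitz letter at the pair (`(W_{x′μ}⁻¹·g(x′)·W_{x′μ}, R(V)δ(x′))`, `(g(x), δ(x))`),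
whose `log u`-difference is `R(V)(D_𝒰φ)(x′,μ)` and whose `δ`-difference is `−i·D*_μD_μφ(x)`. [cite: Balaban1985Averaging, (31) p.22; Balaban1985BackgroundPropagators, (3.3) p.390, (3.8) p.392] -/
theorem norm_transport_rho_sub_rho_le {B₀ B₁ : ℝ} (hB₀ : ∀ x, ‖φ x‖ ≤ B₀) (hB : B₀ ≤ 1 / 512)
    (hB₁ : ∀ μ x, ‖covD (torusT P j) (fun κ z => unitsField (toUField W) ⟨z, κ⟩) μ φ x‖ ≤ B₁) (hB₁' : B₁ ≤ 1 / 256) (μ : Fin P.d) (x : Site P j) :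
    ‖R ((unitsField (toUField W) ⟨(torusT P j μ).symm x, μ⟩)⁻¹)
          (((-Complex.I) • mlog ((GaugeField.gaugeAct (fun z => expHerm (φ z)) W ⟨(torusT P j μ).symm x, μ⟩ * (W ⟨(torusT P j μ).symm x, μ⟩)⁻¹ : Matrix.specialUnitaryGroup (Fin 2) ℂ) : Matrix (Fin 2) (Fin 2) ℂ)) + (covD (torusT P j) (fun κ z => unitsField (toUField W) ⟨z, κ⟩) μ φ ((torusT P j μ).symm x)))
        - (((-Complex.I) • mlog ((GaugeField.gaugeAct (fun z => expHerm (φ z)) W ⟨x, μ⟩ * (W ⟨x, μ⟩)⁻¹ : Matrix.specialUnitaryGroup (Fin 2) ℂ) : Matrix (Fin 2) (Fin 2) ℂ)) + (covD (torusT P j) (fun κ z => unitsField (toUField W) ⟨z, κ⟩) μ φ x))‖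
      ≤ 9 * B₁ * ‖covD (torusT P j) (fun κ z => unitsField (toUField W) ⟨z, κ⟩) μ φ ((torusT P j μ).symm x)‖
        + 18 * B₀ * ‖covDstar (torusT P j) (fun κ z => unitsField (toUField W) ⟨z, κ⟩) μ (covD (torusT P j) (fun κ z => unitsField (toUField W) ⟨z, κ⟩) μ φ) x‖ := by
  have hB4 : B₀ ≤ 1 / 4 := hB.trans (by norm_num)
  have hB2 : B₀ ≤ 1 / 2 := hB.trans (by norm_num)
  have hB1 : B₀ ≤ 1 := hB.trans (by norm_num)
  have hx : torusT P j μ ((torusT P j μ).symm x) = x := Equiv.apply_symm_apply _ _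
  -- the two remainders in px15's variables
  rw [pureGauge_add_covD_eq W φ hφ hB₀ hB4 μ ((torusT P j μ).symm x), pureGauge_add_covD_eq W φ hφ hB₀ hB4 μ x, R_smul, ← smul_sub,
    norm_smul, norm_neg, Complex.norm_I, one_mul]
  -- letters
  have hVb := unitsField_toUField_norm_le_one W ⟨(torusT P j μ).symm x, μ⟩
  have hV : ‖(((unitsField (toUField W) ⟨(torusT P j μ).symm x, μ⟩)⁻¹ : (Matrix (Fin 2) (Fin 2) ℂ)ˣ) : Matrix (Fin 2) (Fin 2) ℂ)‖ ≤ 1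
      ∧ ‖((((unitsField (toUField W) ⟨(torusT P j μ).symm x, μ⟩)⁻¹)⁻¹ : (Matrix (Fin 2) (Fin 2) ℂ)ˣ) : Matrix (Fin 2) (Fin 2) ℂ)‖ ≤ 1 := ⟨hVb.2, by rw [inv_inv]; exact hVb.1⟩
  have hũ : (((W ⟨(torusT P j μ).symm x, μ⟩)⁻¹ * expHerm (φ ((torusT P j μ).symm x)) * W ⟨(torusT P j μ).symm x, μ⟩ : Matrix.specialUnitaryGroup (Fin 2) ℂ) : Matrix (Fin 2) (Fin 2) ℂ)
      = R ((unitsField (toUField W) ⟨(torusT P j μ).symm x, μ⟩)⁻¹) ((expHerm (φ ((torusT P j μ).symm x)) : Matrix.specialUnitaryGroup (Fin 2) ℂ) : Matrix (Fin 2) (Fin 2) ℂ) := by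
    rw [R_inv_unitsField_eq, Submonoid.coe_mul, Submonoid.coe_mul, coe_inv_SU]
  rw [R_diagBCH_eq _ _ _ hũ]
  -- sizes for the diagonal Lipschitz letter
  have hσ : 2 * B₀ ≤ 1 / 256 := by linarith
  have hu : ‖((expHerm (φ x) : Matrix.specialUnitaryGroup (Fin 2) ℂ) : Matrix (Fin 2) (Fin 2) ℂ) - 1‖ ≤ 2 * B₀ := norm_coe_gauge_sub_one_le φ hφ hB₀ hB1 x
  have hu' : ‖(((W ⟨(torusT P j μ).symm x, μ⟩)⁻¹ * expHerm (φ ((torusT P j μ).symm x)) * W ⟨(torusT P j μ).symm x, μ⟩ : Matrix.specialUnitaryGroup (Fin 2) ℂ) : Matrix (Fin 2) (Fin 2) ℂ) - 1‖ ≤ 2 * B₀ := by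
    rw [hũ, ← B9Eq39Adjoint.R_apply_one ((unitsField (toUField W) ⟨(torusT P j μ).symm x, μ⟩)⁻¹), ← R_sub]
    exact (norm_R_le hV.1 hV.2 _).trans (norm_coe_gauge_sub_one_le φ hφ hB₀ hB1 _)
  have hδ : ‖-(Complex.I • (covD (torusT P j) (fun κ z => unitsField (toUField W) ⟨z, κ⟩) μ φ x))‖ ≤ B₁ := by
    rw [norm_neg, norm_smul, Complex.norm_I, one_mul]; exact hB₁ μ x
  have hδ' : ‖R ((unitsField (toUField W) ⟨(torusT P j μ).symm x, μ⟩)⁻¹) (-(Complex.I • (covD (torusT P j) (fun κ z => unitsField (toUField W) ⟨z, κ⟩) μ φ ((torusT P j μ).symm x))))‖ ≤ B₁ := by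
    refine (norm_R_le hV.1 hV.2 _).trans ?_
    rw [norm_neg, norm_smul, Complex.norm_I, one_mul]; exact hB₁ μ _
  have hmain := norm_diagBCH_sub_diagBCH_le ((W ⟨(torusT P j μ).symm x, μ⟩)⁻¹ * expHerm (φ ((torusT P j μ).symm x)) * W ⟨(torusT P j μ).symm x, μ⟩) (expHerm (φ x))
    (R ((unitsField (toUField W) ⟨(torusT P j μ).symm x, μ⟩)⁻¹) (-(Complex.I • (covD (torusT P j) (fun κ z => unitsField (toUField W) ⟨z, κ⟩) μ φ ((torusT P j μ).symm x))))) (-(Complex.I • (covD (torusT P j) (fun κ z => unitsField (toUField W) ⟨z, κ⟩) μ φ x))) hσ hB₁' hu' hu hδ' hδ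
  refine hmain.trans ?_
  -- the `log u`-difference is the transported covariant difference
  have hlog : mlog ((((W ⟨(torusT P j μ).symm x, μ⟩)⁻¹ * expHerm (φ ((torusT P j μ).symm x)) * W ⟨(torusT P j μ).symm x, μ⟩ : Matrix.specialUnitaryGroup (Fin 2) ℂ) : Matrix (Fin 2) (Fin 2) ℂ))
        - mlog ((expHerm (φ x) : Matrix.specialUnitaryGroup (Fin 2) ℂ) : Matrix (Fin 2) (Fin 2) ℂ)
      = -(Complex.I • R ((unitsField (toUField W) ⟨(torusT P j μ).symm x, μ⟩)⁻¹) ((covD (torusT P j) (fun κ z => unitsField (toUField W) ⟨z, κ⟩) μ φ ((torusT P j μ).symm x)))) := by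
    rw [hũ, R_def, B7Prop6Flat.mlog_conj, ← R_def, mlog_coe_gauge_eq φ hφ hB₀ hB2, mlog_coe_gauge_eq φ hφ hB₀ hB2, R_smul, ← smul_sub, ← smul_neg]
    congr 1
    show _ = -(R ((unitsField (toUField W) ⟨(torusT P j μ).symm x, μ⟩)⁻¹)
      (R (unitsField (toUField W) ⟨(torusT P j μ).symm x, μ⟩) (φ (torusT P j μ ((torusT P j μ).symm x))) - φ ((torusT P j μ).symm x)))
    rw [R_sub, B9Eq39Adjoint.R_inv_R, hx]
    abel
  -- the `δ`-difference is the covariant second difference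
  have hdelta : R ((unitsField (toUField W) ⟨(torusT P j μ).symm x, μ⟩)⁻¹) (-(Complex.I • (covD (torusT P j) (fun κ z => unitsField (toUField W) ⟨z, κ⟩) μ φ ((torusT P j μ).symm x)))) - -(Complex.I • (covD (torusT P j) (fun κ z => unitsField (toUField W) ⟨z, κ⟩) μ φ x))
      = -(Complex.I • covDstar (torusT P j) (fun κ z => unitsField (toUField W) ⟨z, κ⟩) μ (covD (torusT P j) (fun κ z => unitsField (toUField W) ⟨z, κ⟩) μ φ) x) := by
    rw [R_neg, R_smul, neg_sub_neg, ← smul_sub, ← smul_neg]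
    congr 1
    show _ = -(R ((unitsField (toUField W) ⟨(torusT P j μ).symm x, μ⟩)⁻¹) (covD (torusT P j) (fun κ z => unitsField (toUField W) ⟨z, κ⟩) μ φ ((torusT P j μ).symm x)) - covD (torusT P j) (fun κ z => unitsField (toUField W) ⟨z, κ⟩) μ φ x)
    rw [neg_sub]
  rw [hlog, hdelta, norm_neg, norm_smul, Complex.norm_I, one_mul, norm_neg, norm_smul, Complex.norm_I, one_mul]
  have h1 : ‖R ((unitsField (toUField W) ⟨(torusT P j μ).symm x, μ⟩)⁻¹) ((covD (torusT P j) (fun κ z => unitsField (toUField W) ⟨z, κ⟩) μ φ ((torusT P j μ).symm x)))‖ ≤ ‖(covD (torusT P j) (fun κ z => unitsField (toUField W) ⟨z, κ⟩) μ φ ((torusT P j μ).symm x))‖ :=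
    norm_R_le hV.1 hV.2 _
  have hB10 : 0 ≤ B₁ := (norm_nonneg _).trans (hB₁ μ x)
  nlinarith [h1, hB10, norm_nonneg (covDstar (torusT P j) (fun κ z => unitsField (toUField W) ⟨z, κ⟩) μ (covD (torusT P j) (fun κ z => unitsField (toUField W) ⟨z, κ⟩) μ φ) x)]

end Transport

/-! ## §4 The covariant divergence of the pure-gauge part -/

section Divergence

variable (W : GaugeField P j (Matrix.specialUnitaryGroup (Fin 2) ℂ)) (φ : Site P j → Matrix (Fin 2) (Fin 2) ℂ)
  (hφ : ∀ x, (φ x).IsHermitian ∧ Matrix.trace (φ x) = 0)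
include hφ

/-- ★★★ **`divB 𝒰 G + Δ_𝒰φ` IS SECOND ORDER**: `‖divB 𝒰 G x + divB 𝒰 (D_𝒰φ) x‖ ≤ Σ_μ (9B₁·‖D_𝒰φ(x−e_μ, μ)‖ + 18B₀·‖D*_μD_μφ(x)‖)` under `‖φ‖ ≤ B₀ ≤ 1∕512`,
`‖D_𝒰φ‖ ≤ B₁ ≤ 1∕256`. [cite: Balaban1985BackgroundPropagators, (3.8) p.392; Balaban1985Averaging, (31) p.22] -/
theorem norm_divB_pureGauge_add_lap_le {B₀ B₁ : ℝ} (hB₀ : ∀ x, ‖φ x‖ ≤ B₀) (hB : B₀ ≤ 1 / 512)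
    (hB₁ : ∀ μ x, ‖covD (torusT P j) (fun κ z => unitsField (toUField W) ⟨z, κ⟩) μ φ x‖ ≤ B₁) (hB₁' : B₁ ≤ 1 / 256) (x : Site P j) :
    ‖divB (torusT P j) (fun κ z => unitsField (toUField W) ⟨z, κ⟩) (fun μ z => (-Complex.I) • mlog ((GaugeField.gaugeAct (fun z => expHerm (φ z)) W ⟨z, μ⟩ * (W ⟨z, μ⟩)⁻¹ : Matrix.specialUnitaryGroup (Fin 2) ℂ) : Matrix (Fin 2) (Fin 2) ℂ)) x + divB (torusT P j) (fun κ z => unitsField (toUField W) ⟨z, κ⟩) (fun μ z => covD (torusT P j) (fun κ z => unitsField (toUField W) ⟨z, κ⟩) μ φ z) x‖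
      ≤ ∑ μ : Fin P.d, (9 * B₁ * ‖covD (torusT P j) (fun κ z => unitsField (toUField W) ⟨z, κ⟩) μ φ ((torusT P j μ).symm x)‖
          + 18 * B₀ * ‖covDstar (torusT P j) (fun κ z => unitsField (toUField W) ⟨z, κ⟩) μ (covD (torusT P j) (fun κ z => unitsField (toUField W) ⟨z, κ⟩) μ φ) x‖) := by
  have hsum : divB (torusT P j) (fun κ z => unitsField (toUField W) ⟨z, κ⟩) (fun μ z => (-Complex.I) • mlog ((GaugeField.gaugeAct (fun z => expHerm (φ z)) W ⟨z, μ⟩ * (W ⟨z, μ⟩)⁻¹ : Matrix.specialUnitaryGroup (Fin 2) ℂ) : Matrix (Fin 2) (Fin 2) ℂ)) x + divB (torusT P j) (fun κ z => unitsField (toUField W) ⟨z, κ⟩) (fun μ z => covD (torusT P j) (fun κ z => unitsField (toUField W) ⟨z, κ⟩) μ φ z) x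
      = ∑ μ : Fin P.d, (R ((unitsField (toUField W) ⟨(torusT P j μ).symm x, μ⟩)⁻¹)
          ((-Complex.I) • mlog ((GaugeField.gaugeAct (fun z => expHerm (φ z)) W ⟨(torusT P j μ).symm x, μ⟩ * (W ⟨(torusT P j μ).symm x, μ⟩)⁻¹ : Matrix.specialUnitaryGroup (Fin 2) ℂ) : Matrix (Fin 2) (Fin 2) ℂ)
            + covD (torusT P j) (fun κ z => unitsField (toUField W) ⟨z, κ⟩) μ φ ((torusT P j μ).symm x))
        - ((-Complex.I) • mlog ((GaugeField.gaugeAct (fun z => expHerm (φ z)) W ⟨x, μ⟩ * (W ⟨x, μ⟩)⁻¹ : Matrix.specialUnitaryGroup (Fin 2) ℂ) : Matrix (Fin 2) (Fin 2) ℂ)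
            + covD (torusT P j) (fun κ z => unitsField (toUField W) ⟨z, κ⟩) μ φ x)) := by
    simp only [divB, ← Finset.sum_add_distrib]
    refine Finset.sum_congr rfl fun μ _ => ?_
    simp only [covDstar, R_add]
    abel
  rw [hsum]
  refine (norm_sum_le _ _).trans (Finset.sum_le_sum fun μ _ => ?_)
  exact norm_transport_rho_sub_rho_le W φ hφ hB₀ hB hB₁ hB₁' μ x

/-- ★★★ **DIVERGENCE ROW OF THE PURE-GAUGE PART**: with the per-direction second-order row `‖D*_μD_μφ‖ ≤ B₂`,
`‖divB 𝒰 G x‖ ≤ d·B₂ + d·(9B₁² + 18B₀B₂)` — k-uniform when `B₁ ≍ ℓ⁻¹`, `B₂ ≍ ℓ⁻²`. [cite: Balaban1985BackgroundPropagators, (3.8) p.392; Balaban1985RegularSpaces, (1.36) p.82] -/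
theorem norm_divB_pureGauge_le {B₀ B₁ B₂ : ℝ} (hB₀ : ∀ x, ‖φ x‖ ≤ B₀) (hB : B₀ ≤ 1 / 512)
    (hB₁ : ∀ μ x, ‖covD (torusT P j) (fun κ z => unitsField (toUField W) ⟨z, κ⟩) μ φ x‖ ≤ B₁) (hB₁' : B₁ ≤ 1 / 256)
    (hB₂ : ∀ μ x, ‖covDstar (torusT P j) (fun κ z => unitsField (toUField W) ⟨z, κ⟩) μ (covD (torusT P j) (fun κ z => unitsField (toUField W) ⟨z, κ⟩) μ φ) x‖ ≤ B₂) (x : Site P j) :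
    ‖divB (torusT P j) (fun κ z => unitsField (toUField W) ⟨z, κ⟩) (fun μ z => (-Complex.I) • mlog ((GaugeField.gaugeAct (fun z => expHerm (φ z)) W ⟨z, μ⟩ * (W ⟨z, μ⟩)⁻¹ : Matrix.specialUnitaryGroup (Fin 2) ℂ) : Matrix (Fin 2) (Fin 2) ℂ)) x‖ ≤ (P.d : ℝ) * B₂ + (P.d : ℝ) * (9 * B₁ ^ 2 + 18 * B₀ * B₂) := by
  have hB00 : 0 ≤ B₀ := (norm_nonneg _).trans (hB₀ x)
  have hB10 : 0 ≤ B₁ := (norm_nonneg _).trans (hB₁ ⟨0, P.hd⟩ x)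
  have h1 := norm_divB_pureGauge_add_lap_le W φ hφ hB₀ hB hB₁ hB₁' x
  have hlap : ‖divB (torusT P j) (fun κ z => unitsField (toUField W) ⟨z, κ⟩) (fun μ z => covD (torusT P j) (fun κ z => unitsField (toUField W) ⟨z, κ⟩) μ φ z) x‖ ≤ (P.d : ℝ) * B₂ := by
    refine (norm_sum_le _ _).trans ?_
    calc ∑ μ : Fin P.d, ‖covDstar (torusT P j) (fun κ z => unitsField (toUField W) ⟨z, κ⟩) μ ((fun μ z => covD (torusT P j) (fun κ z => unitsField (toUField W) ⟨z, κ⟩) μ φ z) μ) x‖ ≤ ∑ _μ : Fin P.d, B₂ := Finset.sum_le_sum fun μ _ => hB₂ μ x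
      _ = (P.d : ℝ) * B₂ := by rw [Finset.sum_const, Finset.card_univ, Fintype.card_fin, nsmul_eq_mul]
  have h2 : ∑ μ : Fin P.d, (9 * B₁ * ‖covD (torusT P j) (fun κ z => unitsField (toUField W) ⟨z, κ⟩) μ φ ((torusT P j μ).symm x)‖
          + 18 * B₀ * ‖covDstar (torusT P j) (fun κ z => unitsField (toUField W) ⟨z, κ⟩) μ (covD (torusT P j) (fun κ z => unitsField (toUField W) ⟨z, κ⟩) μ φ) x‖) ≤ (P.d : ℝ) * (9 * B₁ ^ 2 + 18 * B₀ * B₂) := by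
    calc ∑ μ : Fin P.d, (9 * B₁ * ‖covD (torusT P j) (fun κ z => unitsField (toUField W) ⟨z, κ⟩) μ φ ((torusT P j μ).symm x)‖
          + 18 * B₀ * ‖covDstar (torusT P j) (fun κ z => unitsField (toUField W) ⟨z, κ⟩) μ (covD (torusT P j) (fun κ z => unitsField (toUField W) ⟨z, κ⟩) μ φ) x‖)
        ≤ ∑ _μ : Fin P.d, (9 * B₁ * B₁ + 18 * B₀ * B₂) := Finset.sum_le_sum fun μ _ =>
            add_le_add (mul_le_mul_of_nonneg_left (hB₁ μ _) (by positivity)) (mul_le_mul_of_nonneg_left (hB₂ μ x) (by positivity))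
      _ = (P.d : ℝ) * (9 * B₁ ^ 2 + 18 * B₀ * B₂) := by rw [Finset.sum_const, Finset.card_univ, Fintype.card_fin, nsmul_eq_mul]; ring
  have htri : ‖divB (torusT P j) (fun κ z => unitsField (toUField W) ⟨z, κ⟩) (fun μ z => (-Complex.I) • mlog ((GaugeField.gaugeAct (fun z => expHerm (φ z)) W ⟨z, μ⟩ * (W ⟨z, μ⟩)⁻¹ : Matrix.specialUnitaryGroup (Fin 2) ℂ) : Matrix (Fin 2) (Fin 2) ℂ)) x‖
      ≤ ‖divB (torusT P j) (fun κ z => unitsField (toUField W) ⟨z, κ⟩) (fun μ z => (-Complex.I) • mlog ((GaugeField.gaugeAct (fun z => expHerm (φ z)) W ⟨z, μ⟩ * (W ⟨z, μ⟩)⁻¹ : Matrix.specialUnitaryGroup (Fin 2) ℂ) : Matrix (Fin 2) (Fin 2) ℂ)) x + divB (torusT P j) (fun κ z => unitsField (toUField W) ⟨z, κ⟩) (fun μ z => covD (torusT P j) (fun κ z => unitsField (toUField W) ⟨z, κ⟩) μ φ z) x‖ + ‖divB (torusT P j) (fun κ z => unitsField (toUField W) ⟨z, κ⟩) (fun μ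 z => covD (torusT P j) (fun κ z => unitsField (toUField W) ⟨z, κ⟩) μ φ z) x‖ := by
    have := norm_sub_le (divB (torusT P j) (fun κ z => unitsField (toUField W) ⟨z, κ⟩) (fun μ z => (-Complex.I) • mlog ((GaugeField.gaugeAct (fun z => expHerm (φ z)) W ⟨z, μ⟩ * (W ⟨z, μ⟩)⁻¹ : Matrix.specialUnitaryGroup (Fin 2) ℂ) : Matrix (Fin 2) (Fin 2) ℂ)) x + divB (torusT P j) (fun κ z => unitsField (toUField W) ⟨z, κ⟩) (fun μ z => covD (torusT P j) (fun κ z => unitsField (toUField W) ⟨z, κ⟩) μ φ z) x) (divB (torusT P j) (fun κ z => unitsField (toUField W) ⟨z, κ⟩) (fun μ z => covD (torusT P j) (fun κ z => unitsField (toUField W) ⟨z, κ⟩) μ φ z) x)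
    rwa [add_sub_cancel_right] at this
  linarith [htri, h1, h2, hlap]

end Divergence

end Summit.QuantumFields.YangMills.Theorems.Prop7PureGaugeOfExpRows

end
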